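import Literature.AlgebraicGeometry.Resolution.StrictNormalCrossings
import Literature.AlgebraicGeometry.Resolution.RegularLocalRingsQuotient
import Mathlib.AlgebraicGeometry.AffineScheme
import Mathlib.RingTheory.Nakayama
import HarnessLib

/-!
# A point of a normal crossings divisor with `dim 𝒪 ≥ 2` has a proper generalization inside the divisor

Topic: `Literature/AlgebraicGeometry/Resolution` (proofs only: no new notions, no new named facts).

For the tree's `IsStrictNormalCrossingsDivisor X B` (de Jong 1996, 2.4; `StrictNormalCrossings.lean`: `B` closed, and
at every `p ∈ B` the local ring `𝒪_{X,p}` is regular with a regular system of parameters `x₁,…,x_r,y₁,…,y_e`,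
`r ≥ 1`, such that `B` is cut out by `x₁ ⋯ x_r` on every affine neighbourhood) we prove the elementary
consequence used to exclude degenerate embedded-resolution data:

* `IsStrictNormalCrossingsDivisor.exists_specializes_ne_of_two_le_ringKrullDim` — if `p ∈ B` and
  `dim 𝒪_{X,p} ≥ 2`, some point `η ≠ p` of `B` specializes to `p` (the point of an affine neighbourhood `U`
  corresponding to the prime `(x₁) ∩ Γ(U)` under the prime of `p`: `(x₁)` is a prime of the regular local ring
  `𝒪_{X,p}` containing `x₁ ⋯ x_r`, and it is not the maximal ideal because `dim 𝒪_{X,p} ≥ 2`).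

Equivalently: a point of `B` that is maximal in `B` (a generic point of a component of `B`) has `dim 𝒪_{X,p} ≤ 1` —
the divisor has pure codimension one.

## Sources

* A. J. de Jong, *Smoothness, semi-stability and alterations*, Publ. Math. IHÉS 83 (1996), 2.4. [DeJong1996]
* H. Matsumura, *Commutative Ring Theory* (1987), Thm. 14.2, Thm. 14.3 (quotients of regular local rings by a
  regular parameter are regular, hence domains). [Matsumura1987]
-/

noncomputable section

open CategoryTheory AlgebraicGeometry TopologicalSpace Topology IsLocalRing

namespace Literature.AlgebraicGeometry.Resolution

universe u

open Scheme.IdealSheafData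

/-- Minimal generators of the maximal ideal of a local ring lie outside `𝔪²`: if a finite set `s` generates
`𝔪` and has at most `μ(𝔪)` elements, then no member of `s` lies in `𝔪²` (Nakayama). [cite: Matsumura1987, Thm. 2.3 and §14] -/
private theorem not_mem_sq_of_span_eq_of_ncard_le {O : Type*} [CommRing O] [IsLocalRing O]
    {s : Set O} (hfin : s.Finite) (hs : Ideal.span s = maximalIdeal O)
    (hcard : s.ncard ≤ (maximalIdeal O).spanFinrank) {z : O} (hz : z ∈ s) :
    z ∉ maximalIdeal O ^ 2 := by
  classical
  intro hz2
  set N : Ideal O := Ideal.span (s \ {z}) with hN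
  have hle : maximalIdeal O ≤ N ⊔ maximalIdeal O • maximalIdeal O := by
    conv_lhs => rw [← hs]
    rw [Ideal.span_le]
    intro w hw
    by_cases hwz : w = z
    · subst hwz
      apply Ideal.mem_sup_right
      rw [Ideal.smul_eq_mul, ← pow_two]
      exact hz2
    · exact Ideal.mem_sup_left (Ideal.subset_span ⟨hw, hwz⟩)
  have hfg : (maximalIdeal O).FG := ⟨hfin.toFinset, by rw [Set.Finite.coe_toFinset]; exact hs⟩
  have hjac : maximalIdeal O ≤ (⊥ : Ideal O).jacobson := by
    rw [IsLocalRing.jacobson_eq_maximalIdeal ⊥ bot_ne_top]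
  have hmN : maximalIdeal O ≤ N := Submodule.le_of_le_smul_of_le_jacobson_bot hfg hjac hle
  have hNm : N ≤ maximalIdeal O := by
    rw [hN, ← hs]
    exact Ideal.span_mono Set.sdiff_subset
  have hEq : N = maximalIdeal O := le_antisymm hNm hmN
  have h1 : (maximalIdeal O).spanFinrank ≤ (s \ {z}).ncard := by
    rw [← hEq, hN]
    exact Submodule.spanFinrank_span_le_ncard_of_finite hfin.sdiff
  have h2 : (s \ {z}).ncard + 1 = s.ncard := by
    rw [Set.ncard_sdiff_singleton_of_mem hz]
    have : 0 < s.ncard := (Set.ncard_pos hfin).mpr ⟨z, hz⟩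
    omega
  omega

/-- **A point of a normal crossings divisor at which the ambient local ring has dimension `≥ 2` has a proper
generalization inside the divisor** (so the generic points of the components of `B` have local rings of dimension
`≤ 1`: `B` has pure codimension one). With the local description of de Jong 2.4 at `p ∈ B` — `𝒪_{X,p}` regular with
regular system of parameters `x₁,…,x_r,y₁,…,y_e`, `r ≥ 1`, `B = V(x₁ ⋯ x_r)` near `p` — the ideal `(x₁)` is prime
(Matsumura 14.2/14.3), contains `x₁ ⋯ x_r`, and is not maximal when `dim 𝒪_{X,p} ≥ 2`; the corresponding point of an
affine neighbourhood is the required `η`. [cite: DeJong1996, 2.4, p. 55] [cite: Matsumura1987, Thm. 14.2] -/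
theorem IsStrictNormalCrossingsDivisor.exists_specializes_ne_of_two_le_ringKrullDim
    {X : Scheme.{u}} {B : Set X} (hB : IsStrictNormalCrossingsDivisor X B) {p : X} (hp : p ∈ B)
    (h2 : (2 : WithBot ℕ∞) ≤ ringKrullDim (X.presheaf.stalk p)) :
    ∃ η ∈ B, η ⤳ p ∧ η ≠ p := by
  classical
  obtain ⟨hregp, r, e, x, y, hr, hdim, hspan, hloc⟩ := hB.2 p hp
  -- an affine open neighbourhood of `p`
  obtain ⟨_, ⟨U, hU, rfl⟩, hpU, -⟩ :=
    X.isBasis_affineOpens.exists_subset_of_mem_open (Set.mem_univ p) isOpen_univ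
  -- the stalk is the localization of `Γ(X, U)` at the prime of `p`
  haveI : IsRegularLocalRing (X.presheaf.stalk p) := hregp
  letI : Algebra Γ(X, U) (X.presheaf.stalk p) :=
    TopCat.Presheaf.algebra_section_stalk X.presheaf (⟨p, hpU⟩ : U)
  haveI hlocal : IsLocalization.AtPrime (X.presheaf.stalk p) (hU.primeIdealOf ⟨p, hpU⟩).asIdeal :=
    hU.isLocalization_stalk ⟨p, hpU⟩
  set 𝔭 : Ideal Γ(X, U) := (hU.primeIdealOf ⟨p, hpU⟩).asIdeal with h𝔭def
  -- the parameter `x₀ ∈ 𝔪 ∖ 𝔪²`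
  set i₀ : Fin r := ⟨0, hr⟩ with hi₀
  have hsfin : (Set.range x ∪ Set.range y).Finite := (Set.finite_range x).union (Set.finite_range y)
  have hreg := (isRegularLocalRing_iff (X.presheaf.stalk p)).mp hregp
  have hμ : (maximalIdeal (X.presheaf.stalk p)).spanFinrank = r + e := by
    have h := hreg.trans hdim
    exact_mod_cast h
  have hcard : (Set.range x ∪ Set.range y).ncard ≤ (maximalIdeal (X.presheaf.stalk p)).spanFinrank := by
    rw [hμ]
    calc (Set.range x ∪ Set.range y).ncard
        ≤ (Set.range x).ncard + (Set.range y).ncard := Set.ncard_union_le _ _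
      _ ≤ r + e := by
          gcongr
          · have : Set.range x = ((Finset.univ.image x : Finset _) : Set _) := by
              rw [Finset.coe_image, Finset.coe_univ, Set.image_univ]
            rw [this, Set.ncard_coe_finset]
            exact (Finset.card_image_le).trans (by simp)
          · have : Set.range y = ((Finset.univ.image y : Finset _) : Set _) := by
              rw [Finset.coe_image, Finset.coe_univ, Set.image_univ]
            rw [this, Set.ncard_coe_finset]
            exact (Finset.card_image_le).trans (by simp)
  have hx0m : x i₀ ∈ maximalIdeal (X.presheaf.stalk p) :=
    hspan ▸ Ideal.subset_span (Or.inl ⟨i₀, rfl⟩)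
  have hx0sq : x i₀ ∉ maximalIdeal (X.presheaf.stalk p) ^ 2 :=
    not_mem_sq_of_span_eq_of_ncard_le hsfin hspan hcard (Or.inl ⟨i₀, rfl⟩)
  have hprime : Prime (x i₀) := IsRegularLocalRing.prime_of_not_mem_sq hx0m hx0sq
  set q : Ideal (X.presheaf.stalk p) := Ideal.span {x i₀} with hqdef
  haveI hq : q.IsPrime := (Ideal.span_singleton_prime hprime.ne_zero).mpr hprime
  -- `q ≠ 𝔪` since `dim ≥ 2`
  have hqm : q ≠ maximalIdeal (X.presheaf.stalk p) := by
    intro hqm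
    have h1 : (maximalIdeal (X.presheaf.stalk p)).spanFinrank ≤ 1 := by
      rw [← hqm, hqdef]
      simpa using Submodule.spanFinrank_span_le_ncard_of_finite (Set.finite_singleton (x i₀))
    have h3 : (2 : WithBot ℕ∞) ≤ ((maximalIdeal (X.presheaf.stalk p)).spanFinrank : WithBot ℕ∞) := by
      rw [hreg]; exact h2
    have h4 : (2 : ℕ) ≤ (maximalIdeal (X.presheaf.stalk p)).spanFinrank := by exact_mod_cast h3
    omega
  -- the prime `𝔮'` of `Γ(X, U)` under `q`, strictly inside `𝔭`
  set 𝔮' : Ideal Γ(X, U) := q.comap (algebraMap Γ(X, U) (X.presheaf.stalk p)) with h𝔮'def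
  haveI h𝔮' : 𝔮'.IsPrime := Ideal.IsPrime.comap _
  have hqle : q ≤ maximalIdeal (X.presheaf.stalk p) := IsLocalRing.le_maximalIdeal hq.ne_top
  have h𝔮'𝔭 : 𝔮' ≤ 𝔭 := by
    intro a ha
    exact (IsLocalization.AtPrime.to_map_mem_maximal_iff (X.presheaf.stalk p) 𝔭 a).mp (hqle ha)
  have h𝔮'ne : 𝔮' ≠ 𝔭 := by
    intro h
    apply hqm
    have e1 : 𝔮'.map (algebraMap Γ(X, U) (X.presheaf.stalk p)) = q := by
      have := IsLocalization.map_under 𝔭.primeCompl (X.presheaf.stalk p) q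
      rwa [Ideal.under_def] at this
    rw [← e1, h]
    exact IsLocalization.AtPrime.map_eq_maximalIdeal 𝔭 (X.presheaf.stalk p)
  -- the point `η`
  let η' : PrimeSpectrum Γ(X, U) := ⟨𝔮', h𝔮'⟩
  have hη'le : η' ≤ hU.primeIdealOf ⟨p, hpU⟩ := h𝔮'𝔭
  refine ⟨hU.fromSpec η', ?_, ?_, ?_⟩
  · -- `η ∈ B`: `𝔮'` contains the sections of the vanishing ideal of `B` over `U`
    have hIq : (vanishingIdeal ⟨closure B, isClosed_closure⟩).ideal ⟨U, hU⟩ ≤ 𝔮' := by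
      intro a ha
      change algebraMap Γ(X, U) (X.presheaf.stalk p) a ∈ q
      have hmem : algebraMap Γ(X, U) (X.presheaf.stalk p) a ∈
          ((vanishingIdeal ⟨closure B, isClosed_closure⟩).ideal ⟨U, hU⟩).map
            (X.presheaf.germ U p hpU).hom := Ideal.mem_map_of_mem _ ha
      rw [hloc ⟨U, hU⟩ hpU] at hmem
      exact Ideal.span_singleton_le_span_singleton.mpr
        (Finset.dvd_prod_of_mem x (Finset.mem_univ i₀)) hmem
    have hmemZ : η' ∈ PrimeSpectrum.zeroLocus
        (((vanishingIdeal ⟨closure B, isClosed_closure⟩).ideal ⟨U, hU⟩ : Ideal Γ(X, U)) : Set Γ(X, U)) :=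
      fun a ha => hIq ha
    rw [vanishingIdeal_ideal, PrimeSpectrum.zeroLocus_vanishingIdeal_eq_closure] at hmemZ
    have hmemZ' := (IsClosed.preimage (Scheme.Hom.continuous _) (Closeds.isClosed _)).closure_subset hmemZ
    have : hU.fromSpec η' ∈ closure B := hmemZ'
    rwa [hB.isClosed.closure_eq] at this
  · -- `η ⤳ p`
    have hsp : η' ⤳ hU.primeIdealOf ⟨p, hpU⟩ := (PrimeSpectrum.le_iff_specializes _ _).mp hη'le
    have := hsp.map hU.fromSpec.continuous
    rwa [IsAffineOpen.fromSpec_primeIdealOf] at this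
  · -- `η ≠ p`
    intro h
    have hinj := hU.fromSpec.isOpenEmbedding.injective
    have : η' = hU.primeIdealOf ⟨p, hpU⟩ :=
      hinj (h.trans (hU.fromSpec_primeIdealOf ⟨p, hpU⟩).symm)
    exact h𝔮'ne (congrArg (fun P : PrimeSpectrum Γ(X, U) => P.asIdeal) this)

end Literature.AlgebraicGeometry.Resolution

end
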